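import Summits.AtomisticToContinuum.Crystallization.Theorems.PricedLinkCensusLocalToGlobalPhaseGapDefs
import Summits.AtomisticToContinuum.Crystallization.Theorems.PricedLinkCensusStackingHingeEStarStrict

/-!
# Crux `LocalToGlobal` (stmt-AtomisticToContinuum-14232), line `phase-gap-rate-upgrade`:
# the phase gap Sub₁ is equivalent to its eventually-in-`N` form

Stub `qualitativeChargeGap_of_eventually` of the line.  The qualitative phase gap at tolerance `η`,
`QualitativeChargeGapWith η : ∀ ρ > 0, ∃ g > 0, PhaseGapWith η ρ g` (every finite injective configuration of
`ℝ³` with at least `ρ·N` charged sites has `N·(e* + g) ≤ E_LJ`), follows from its large-`N` form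
`QualitativeChargeGapEventuallyWith η` (the same for `N ≥ N₀(ρ)` only): the SMALL-`N` regime is automatic and
needs no charge hypothesis at all.

* `exists_gap_of_pos` — for each FIXED `N ≥ 1` there is `g_N > 0` with `N·(e* + g_N) ≤ E_LJ(y)` for EVERY
  injective `y : Fin N → ℝ³`: take a Lennard-Jones ground state `x` of `N` particles
  (`LennardJonesGroundStatesExist_holds`), so `E_LJ(x) = E(N) ≤ E_LJ(y)` (`groundStateEnergy_lennardJones_le`),
  and `N·e* < E_LJ(x)` STRICTLY (`PricedHcpWindowsEStarStrict.stub_eStarStrict`); put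
  `g_N = (E(N) − N·e*)/N`.
* `exists_uniform_gap_lt` — a uniform gap over `1 ≤ N < N₀`, the minimum of finitely many positive numbers
  (induction on `N₀`).
* `qualitativeChargeGap_of_eventually` — given `ρ > 0`, the hypothesis gives `g` and `N₀`; with the uniform
  small-`N` gap `g'` below `N₀` the gap `min g g'` works for all `N` (`N = 0`: both sides vanish).
* `qualitativeChargeGapEventually_of_qualitativeChargeGap`, `qualitativeChargeGap_iff_eventually` — the trivial
  converse (`N₀ = 0`) and the equivalence.

All `[folklore]`.  No hypothesis on `η` is needed.
-/

noncomputable section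

namespace Summit.AtomisticToContinuum.Crystallization.Theorems.PricedLinkCensusLocalToGlobalPhaseGap

open Literature.MathematicalPhysics.StatisticalMechanics
open Literature.Geometry.DiscreteGeometry
open Summit.AtomisticToContinuum.Crystallization.Theses.PricedLinkCensus
open Summit.AtomisticToContinuum.Crystallization.Theorems.ChargedEnergyGapNegative
open Summit.AtomisticToContinuum.Crystallization.Theorems.PricedHcpWindowsEStarStrict (stub_eStarStrict)
open scoped BigOperators

/-! ## A positive gap at each fixed particle number -/

/-- **A positive gap at fixed `N ≥ 1`**: there is `g > 0` with `N·(e* + g) ≤ E_LJ(y)` for every injective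
`y : Fin N → ℝ³`.  With a ground state `x` of the `N`-particle problem (`LennardJonesGroundStatesExist_holds`),
`g = (E_LJ(x) − N·e*)/N` is positive by the strict inequality `N·e* < E_LJ(x)` (`stub_eStarStrict`), and
`E_LJ(x) = E(N) ≤ E_LJ(y)` (`groundStateEnergy_lennardJones_le`). [folklore] -/
theorem exists_gap_of_pos {N : ℕ} (hN : 0 < N) :
    ∃ g : ℝ, 0 < g ∧ ∀ y : Fin N → E3, Function.Injective y →
      (N : ℝ) * (eStar + g) ≤ interactionEnergy lennardJones y := by
  obtain ⟨x, hx_inj, hx_E⟩ := LennardJonesGroundStatesExist_holds N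
  have hstrict : (N : ℝ) * eStar < interactionEnergy lennardJones x := stub_eStarStrict N x hN hx_inj
  have hNr : (0 : ℝ) < N := by exact_mod_cast hN
  refine ⟨(interactionEnergy lennardJones x - N * eStar) / N, div_pos (by linarith) hNr, fun y hy => ?_⟩
  have hle : interactionEnergy lennardJones x ≤ interactionEnergy lennardJones y := by
    rw [hx_E]
    exact groundStateEnergy_lennardJones_le hy
  rw [mul_add, mul_div_cancel₀ _ hNr.ne']
  linarith

/-- **A uniform gap below `N₀`**: for every `N₀` there is `g > 0` with `N·(e* + g) ≤ E_LJ(y)` for every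
`1 ≤ N < N₀` and every injective `y : Fin N → ℝ³` — the minimum of the finitely many positive gaps
`g_1, …, g_{N₀−1}` of `exists_gap_of_pos` (induction on `N₀`; any positive number for `N₀ ≤ 1`). [folklore] -/
theorem exists_uniform_gap_lt : ∀ N₀ : ℕ, ∃ g : ℝ, 0 < g ∧ ∀ (N : ℕ) (y : Fin N → E3), 0 < N → N < N₀ →
    Function.Injective y → (N : ℝ) * (eStar + g) ≤ interactionEnergy lennardJones y := by
  intro N₀
  induction N₀ with
  | zero => exact ⟨1, one_pos, fun N y _ hN₀ _ => absurd hN₀ (Nat.not_lt_zero N)⟩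
  | succ N₀ ih =>
    obtain ⟨g, hg, hgN⟩ := ih
    rcases Nat.eq_zero_or_pos N₀ with h0 | hpos
    · subst h0
      exact ⟨1, one_pos, fun N y hN hN₀ _ => by omega⟩
    · obtain ⟨g₀, hg₀, hg₀N⟩ := exists_gap_of_pos hpos
      refine ⟨min g g₀, lt_min hg hg₀, fun N y hN hN₀ hy => ?_⟩
      have hNr : (0 : ℝ) ≤ N := Nat.cast_nonneg N
      rcases Nat.lt_or_ge N N₀ with hlt | hge
      · have h1 := hgN N y hN hlt hy
        have h2 : (N : ℝ) * (eStar + min g g₀) ≤ (N : ℝ) * (eStar + g) :=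
          mul_le_mul_of_nonneg_left (by linarith [min_le_left g g₀]) hNr
        exact h2.trans h1
      · obtain rfl : N = N₀ := by omega
        have h1 := hg₀N y hy
        have h2 : (N : ℝ) * (eStar + min g g₀) ≤ (N : ℝ) * (eStar + g₀) :=
          mul_le_mul_of_nonneg_left (by linarith [min_le_right g g₀]) hNr
        exact h2.trans h1

/-! ## The stub: Sub₁ from its eventually-in-`N` form -/

/-- **Stub `qualitativeChargeGap_of_eventually`** (line `phase-gap-rate-upgrade` of crux
stmt-AtomisticToContinuum-14232): the qualitative phase gap at tolerance `η` follows from its large-`N` form.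
Given `ρ > 0`, the hypothesis supplies `g > 0` and `N₀` serving all `N ≥ N₀`; the uniform small-`N` gap `g'` of
`exists_uniform_gap_lt N₀` serves `1 ≤ N < N₀` (ignoring the charge hypothesis); `min g g'` serves both (the
inequality is antitone in the gap since `N ≥ 0`), and for `N = 0` both sides vanish.  No hypothesis on `η`.
[folklore] -/
theorem qualitativeChargeGap_of_eventually : ∀ η : ℝ, QualitativeChargeGapEventuallyWith η → QualitativeChargeGapWith η := by
  intro η h
  rw [qualitativeChargeGapWith_iff]
  intro ρ hρ
  obtain ⟨g, hg, N₀, hgN⟩ := h ρ hρ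
  obtain ⟨g', hg', hg'N⟩ := exists_uniform_gap_lt N₀
  refine ⟨min g g', lt_min hg hg', fun N y hy hρN => ?_⟩
  have hNr : (0 : ℝ) ≤ N := Nat.cast_nonneg N
  rcases Nat.lt_or_ge N N₀ with hlt | hge
  · rcases Nat.eq_zero_or_pos N with h0 | hpos
    · subst h0
      simp [interactionEnergy]
    · have h1 := hg'N N y hpos hlt hy
      have h2 : (N : ℝ) * (eStar + min g g') ≤ (N : ℝ) * (eStar + g') :=
        mul_le_mul_of_nonneg_left (by linarith [min_le_right g g']) hNr
      exact h2.trans h1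
  · have h1 := hgN N y hge hy hρN
    have h2 : (N : ℝ) * (eStar + min g g') ≤ (N : ℝ) * (eStar + g) :=
      mul_le_mul_of_nonneg_left (by linarith [min_le_left g g']) hNr
    exact h2.trans h1

/-- The trivial converse: the phase gap implies its large-`N` form (`N₀ = 0`). [folklore] -/
theorem qualitativeChargeGapEventually_of_qualitativeChargeGap (η : ℝ) (h : QualitativeChargeGapWith η) :
    QualitativeChargeGapEventuallyWith η := by
  rw [qualitativeChargeGapWith_iff] at h
  intro ρ hρ
  obtain ⟨g, hg, hP⟩ := h ρ hρ
  exact ⟨g, hg, 0, fun N y _ hy hρN => hP N y hy hρN⟩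

/-- **Sub₁ is equivalent to its eventually-in-`N` form**:
`QualitativeChargeGapWith η ↔ QualitativeChargeGapEventuallyWith η`. [folklore] -/
theorem qualitativeChargeGap_iff_eventually (η : ℝ) :
    QualitativeChargeGapWith η ↔ QualitativeChargeGapEventuallyWith η :=
  ⟨qualitativeChargeGapEventually_of_qualitativeChargeGap η, qualitativeChargeGap_of_eventually η⟩

end Summit.AtomisticToContinuum.Crystallization.Theorems.PricedLinkCensusLocalToGlobalPhaseGap

end
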